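import Literature.Probability.FitznerVanDerHofstad2017.NobleBoundsN1Class00
import HarnessLib

/-!
# [FvdH17] §6.1 — the `(0,0)`-square device of (Bound-Xi-case-abZero-split) at event level (class `(0,0)`, bond `(u,t)` closed)

Source: R. Fitzner, R. van der Hofstad, *Mean-field behavior for nearest-neighbor percolation in d > 10*,
Electron. J. Probab. 22 (2017) no. 43, §6.1, proof of Lemma 5.1, the display (Bound-Xi-case-abZero-split) and the two
sentences around it (arXiv:1506.07977v2 p. 60): "we extract the contributions in which `b̲₀ = 0`, `{t̄_{b₀} ↔ x}` is cut
through at `x` and the connection to the cutting point is established in `C̃₀^{(0,y)}` directly, so via the bond `(0,x)`.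
This corresponds to a contribution of `a = b = 0` in which `t` and `u` are directly connected.  We split the bound in
(Bound-Xi-case-abZero) into `𝓣_{1̲,1,1̲}(e_ι,t−u,0) + 𝓣_{1̲,1,2}(e_ι,t−u,0)`, and see that the first term corresponds to
the event we removed with `Ξ^{(1)}_{α,p}(x)`.  In (lemmapercboundXi1-3) we simply remove the bound in
(Bound-Xi-case-abZero) and replace it with a bound on the second term".

This module proves the EVENT-LEVEL half of that sentence, d-generic and assignment-free: on the class `(0,0)` of the
joint witness event `jointWit u v w z t x` (`NobleJointTwoLevel`, `NobleBoundsN1Classes`) intersected with the level-`0`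
cylinder `{ω | s(u,t) ∉ ω 0}` ("`t` and `u` are NOT directly connected on level `0`"), the bound of
`NobleBoundsN1Class00.jointWit_cls_0_0` holds with the middle letter `Ā'^{ι,0,0}(u,w,t,z) = 𝓣_{1̲,1,1}(e_ι,t−u,0)` replaced
by `𝓣_{1̲,1,2}(e_ι,t−u,0)` (`jointWit_cls_0_0_offBond`).  The complementary cylinder (bond `(u,t)` open, `u = 0`,
`t = x`) is the part extracted by `Ξ^{(1)}_α` (`NoblePercolationSplit.nobleXiA1T`); the identification of that part and
the one-member extraction in the summation (6.4) ⇒ (6.5) are separate modules.  The proof is the proof of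
`jointWit_cls_0_0` verbatim (grouped BK inequality over the pools `src00`), plus one step: the level-`0` witness of
`{t ↔ u}` lies in `ω 0 ∌ s(u,t)`, so it witnesses `{t ←2→ u}` (`NoblePercLettersTransport.mem_openConnGe_two_of_notMem`);
and the cylinder, like the class, does not read the coordinate `b₀ = (u,v)` (`t ≠ v` on the class), so the absorption of
the factor `p` as the open bond `b₀` (`NobleBoundsN1ClassTools.ofReal_mul_piPerc_preimage_eraseAt0`) goes through.
No hypothesis beyond the displayed objects; no numeral; no dimension; nothing here is a certificate statement.
-/

namespace Literature.Probability.FitznerVanDerHofstad2017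

open Literature.Barriers.CriticalPhenomena Literature.Probability.Percolation Literature.Probability.LatticeModels
open Literature.Probability.FitznerVanDerHofstad2017.NobleBlocks MeasureTheory
open Literature.Probability.FitznerVanDerHofstad2017.NobleBlocks.LenIdx
open scoped ENNReal BigOperators

variable {d : ℕ}

/-- **Middle piece of the `(0,0)`-square device**: the three lines `{u ←1̲→ v}₀`, `{v ←1→ t}₁`, `{t ←2→ u}₀`
(`v = u + e_ι`) are bounded by the repulsive letter `𝓣_{1̲,1,2}(e_ι, t−u, 0)` — the second term of
(Bound-Xi-case-abZero-split).  (`NoblePercLettersTransport.piPerc_two_genDisjOcc_le_T`, generic in the length indices.)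
[cite: FitznerVanDerHofstad2017, §6.1 (Bound-Xi-case-abZero-split) (arXiv:1506.07977v2 p. 60); (5.3) (p. 46)] -/
theorem piPerc_mid_zero_zero_offBond_le_T (p : unitInterval) {ι : Fin d × Bool} {u v t : Site d}
    (hv : v = u + stepVec ι) (c : Fin 3 → Fin 2) :
    piPerc d p 2 (genDisjOcc ![event (eq 1) u v, event (ge 1) v t, event (ge 2) t u] c) ≤
      (Letters.perc d p).T (eq 1) (ge 1) (ge 2) (stepVec ι) (t - u) 0 := by
  have he : v - u = stepVec ι := by rw [hv, add_sub_cancel_left]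
  have h := piPerc_two_genDisjOcc_le_T p (eq 1) (ge 1) (ge 2) u v t u c
  rwa [he, sub_self] at h

/-- **[FvdH17] §6.1, the `(0,0)`-square device of (Bound-Xi-case-abZero-split) at event level.**  On the class
`(0,0)` intersected with the level-`0` cylinder "the bond `(u,t)` is CLOSED on level `0`", the third middle line
`{t ↔ u}₀` is witnessed OFF the bond `(u,t)`, hence is `{t ←2→ u}₀`, and the middle letter improves from the repulsive
`𝓣_{1̲,1,1}(e_ι,t−u,0)` (`= Ā'^{ι,0,0}`) to `𝓣_{1̲,1,2}(e_ι,t−u,0)`: "We split the bound (Bound-Xi-case-abZero) into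
`𝓣_{1̲,1,1̲}(e_ι,t−u,0) + 𝓣_{1̲,1,2}(e_ι,t−u,0)` and see that the first term corresponds to the event we removed with
`Ξ^{(1)}_{α,p}(x)`" — the removed event being "`b̲₀ = 0`, `{t̄_{b₀} ↔ x}` is cut through at `x` and the connection to the
cutting point is established … directly, so via the bond `(0,x)`", i.e. the member `u = 0`, `t = z = x` of this class with
`(u,t)` OPEN.  Same proof as `jointWit_cls_0_0` (grouped BK over the same pools `src00`); the only new step is
`NoblePercLettersTransport.mem_openConnGe_two_of_notMem` on the level-`0` witness of `{t ↔ u}`.  No hypothesis beyond the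
displayed objects; no numeral; no dimension.
[cite: FitznerVanDerHofstad2017, §6.1 (Bound-Xi-case-abZero-split), proof of Lemma 5.1 (lemmapercboundXi1-3) (arXiv:1506.07977v2 p. 60)] -/
theorem jointWit_cls_0_0_offBond (p : unitInterval) (x u v w z t : Site d) :
    ENNReal.ofReal (bondJ d p (v - u)) *
        piPerc d p 2 (jointWit u v w z t x ∩ clsSet u w t z 0 0 ∩ {ω | s(u, t) ∉ ω 0}) ≤
      ∑ ι : Fin d × Bool, (if v = u + stepVec ι then (1 : ℝ≥0∞) else 0) *
        (blockPS (Letters.perc d p) 0 u w *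
          (Letters.perc d p).T (eq 1) (ge 1) (ge 2) (stepVec ι) (t - u) 0 *
          blockPE (Letters.perc d p) 0 (t - x) (z - x)) := by
  classical
  set F := jointWit u v w z t x ∩ clsSet u w t z 0 0 ∩ {ω | s(u, t) ∉ ω 0} with hF
  -- the bond factor `J(v - u)`
  by_cases hadj : (zdGraph d).Adj 0 (v - u)
  swap
  · rw [ofReal_bondJ_eq_zero_of_not_adj p hadj, zero_mul]; exact zero_le
  obtain ⟨ι₀, hι₀⟩ := (zdGraph_adj_iff_stepVec 0 (v - u)).1 hadj
  have hv : v = u + stepVec ι₀ := by rw [zero_add] at hι₀; exact sub_eq_iff_eq_add'.1 hι₀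
  have huv : u ≠ v := by rintro rfl; rw [sub_self] at hadj; exact hadj.ne rfl
  have he : s(u, v) ∈ (zdGraph d).edgeSet :=
    (SimpleGraph.mem_edgeSet _).2 ((zdGraph_adj_iff_stepVec u v).2 ⟨ι₀, hv⟩)
  rw [bondJ_def, if_pos hadj]
  -- an empty class contributes nothing; otherwise read off the side conditions
  by_cases hne : F.Nonempty
  swap
  · rw [Set.not_nonempty_iff_eq_empty.1 hne, measure_empty, mul_zero]; exact zero_le
  obtain ⟨ω₀, ⟨hjw₀, hcls₀⟩, -⟩ := hne
  obtain ⟨⟨-, -, -, hzv, htu, -, -⟩, -⟩ := (mem_jointWit_iff u v w z t x ω₀).1 hjw₀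
  have hwu : u = w := (mem_lineCls_zero_iff u w 0 ω₀).1 hcls₀.1
  have hzt : t = z := (mem_lineCls_zero_iff t z 1 ω₀).1 hcls₀.2
  have htv : t ≠ v := fun h => hzv (hzt ▸ h)
  have hvt : v ≠ t := fun h => htv h.symm
  -- the `ι`-sum is at least its `ι₀` term
  refine le_trans ?_ (term_le_sum_ite ι₀ hv _)
  -- absorb `p` as the open bond `b₀` on level `0`
  have hCm : MeasurableSet {ω : Fin 2 → BondConfig (Site d) | s(u, t) ∉ ω 0} :=
    ((measurableSet_mem s(u, t)).preimage (measurable_pi_apply 0)).compl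
  have hFm : MeasurableSet F :=
    ((measurableSet_jointWit u v w z t x).inter (measurableSet_clsSet u w t z 0 0)).inter hCm
  -- the cylinder does not read the bond `b₀ = (u,v)` either (`t ≠ v`)
  have hut : s(u, t) ≠ s(u, v) := fun h => htv (Sym2.congr_right.1 h)
  have hpre : eraseAt0 s(u, v) ⁻¹' F = F := by
    rw [hF, Set.preimage_inter, eraseAt0_preimage_jointWit_inter_clsSet]
    congr 1
    ext ω
    simp only [Set.mem_preimage, Set.mem_setOf_eq, eraseAt0_apply_zero, Set.mem_sdiff, Set.mem_singleton_iff,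
      not_and, not_not]
    exact ⟨fun h hm => hut (h hm), fun h hm => absurd hm h⟩
  have habs := ofReal_mul_piPerc_preimage_eraseAt0 p he hFm
  rw [hpre] at habs
  rw [habs]
  -- the regrouped line families
  set AS : Fin 2 → Set (BondConfig (Site d)) := ![event (ge 0) 0 u, event (ge 0) 0 u] with hAS
  set AM : Fin 3 → Set (BondConfig (Site d)) := ![event (eq 1) u v, event (ge 1) v t, event (ge 2) t u] with hAM
  set AE : Fin 2 → Set (BondConfig (Site d)) := ![event (ge 0) x t, event (ge 0) x t] with hAE
  set cS : Fin 2 → Fin 2 := ![0, 0] with hcS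
  set cM : Fin 3 → Fin 2 := ![0, 1, 0] with hcM
  set cE : Fin 2 → Fin 2 := ![1, 1] with hcE
  -- witness-level inclusion into the grouped event
  have hincl : {ω : Fin 2 → BondConfig (Site d) | s(u, v) ∈ ω 0} ∩ F ⊆
      genDisjOccGrouped (Sum.elim AS (Sum.elim AM AE)) (Sum.elim cS (Sum.elim cM cE)) tag3 := by
    rintro ω ⟨hb0, ⟨hjw, -⟩, hcyl⟩
    obtain ⟨-, K₀, K₁, h₀, h₁, hA₀, hA₁, hd₀, hd₁, hc₀, -, -⟩ := (mem_jointWit_iff u v w z t x ω).1 hjw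
    have hK₀ω : ∀ j, K₀ j ⊆ ω 0 := fun j => (h₀ j).trans (offBonds_subset _ _)
    have hK₁ω : ∀ j, K₁ j ⊆ ω 1 := fun j => (h₁ j).trans (offBonds_subset _ _)
    have hb₀K₀ : ∀ j, Disjoint (K₀ j) {s(u, v)} := fun j => Set.disjoint_singleton_right.2 fun h => by
      have h' := h₀ j h; rw [offBonds_def] at h'; exact h'.2 rfl
    have hb₀K₁ : ∀ j, Disjoint ({s(u, v)} : Set (Sym2 (Site d))) (K₁ j) := fun j =>
      Set.disjoint_singleton_left.2 fun h => by
        have h' := h₁ j h; rw [offBonds_def] at h'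
        exact h'.2 ((mem_bondsAt_singleton_iff u _).2 (Sym2.mem_mk_left u v))
    have hK00 : K₀ 0 ∈ (openConn 0 u : Set (BondConfig (Site d))) := hA₀ 0
    have hK01 : K₀ 1 ∈ (openConn 0 w : Set (BondConfig (Site d))) := hA₀ 1
    have hK03 : K₀ 3 ∈ (openConn w z : Set (BondConfig (Site d))) := hA₀ 3
    have hK10 : K₁ 0 ∈ (openConn v t : Set (BondConfig (Site d))) := hA₁ 0
    have hK12 : K₁ 2 ∈ (openConn t x : Set (BondConfig (Site d))) := hA₁ 2
    have hK13 : K₁ 3 ∈ (openConn z x : Set (BondConfig (Site d))) := hA₁ 3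
    have hK03' : K₀ 3 ∈ (openConn t u : Set (BondConfig (Site d))) := by
      have h : K₀ 3 ∈ (openConn u t : Set (BondConfig (Site d))) := by rw [hwu, hzt]; exact hK03
      exact SimpleGraph.Reachable.symm h
    -- the closed bond `(u,t)` forces the level-`0` witness of `{t ↔ u}` off it: `{t ←2→ u}`
    have hK03'' : K₀ 3 ∈ openConnGe 2 t u :=
      mem_openConnGe_two_of_notMem hK03' htu fun h => hcyl (by rw [Sym2.eq_swap] at h; exact hK₀ω 3 h)
    refine mem_genDisjOccGrouped_of_pools₃ _ _ _ ω ![K₀ 0, K₀ 1, K₀ 3, {s(u, v)}] ![K₁ 0] ![K₁ 2, K₁ 3]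
      ?_ ?_ ?_ ?_ ?_ ?_ src00 (by decide) ?_ ?_ (by decide)
    · intro a; fin_cases a
      · exact hK₀ω 0
      · exact hK₀ω 1
      · exact hK₀ω 3
      · exact Set.singleton_subset_iff.2 hb0
    · intro b; fin_cases b; exact hK₁ω 0
    · intro r; fin_cases r
      · exact hK₁ω 2
      · exact hK₁ω 3
    · exact pairwise_disjoint_vec4 (hd₀ (by decide)) (hd₀ (by decide)) (hb₀K₀ 0) (hd₀ (by decide))
        (hb₀K₀ 1) (hb₀K₀ 3)
    · rintro (b | b) (b' | b') hbb' <;> fin_cases b <;> fin_cases b' <;> simp at hbb' ⊢ <;> exact hd₁ (by decide)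
    · intro a b; fin_cases a <;> fin_cases b
      · exact (hc₀ 0).symm
      · exact (hc₀ 1).symm
      · exact (hc₀ 3).symm
      · exact hb₀K₁ 0
    · rintro (i | i | i) <;> fin_cases i <;> rfl
    · rintro (i | i | i) <;> fin_cases i
      · show K₀ 0 ∈ (event (ge 0) 0 u : Set (BondConfig (Site d)))
        rw [event_ge, openConnGe_zero]; exact hK00
      · show K₀ 1 ∈ (event (ge 0) 0 u : Set (BondConfig (Site d)))
        rw [event_ge, openConnGe_zero, hwu]; exact hK01
      · show ({s(u, v)} : Set (Sym2 (Site d))) ∈ (event (eq 1) u v : Set (BondConfig (Site d)))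
        rw [event_eq]; exact mem_openConnEq_one_of_mem huv (Set.mem_singleton _)
      · show K₁ 0 ∈ (event (ge 1) v t : Set (BondConfig (Site d)))
        rw [event_ge, openConnGe_one_eq hvt]; exact hK10
      · show K₀ 3 ∈ (event (ge 2) t u : Set (BondConfig (Site d)))
        rw [event_ge]; exact hK03''
      · show K₁ 2 ∈ (event (ge 0) x t : Set (BondConfig (Site d)))
        rw [event_ge, openConnGe_zero]; exact SimpleGraph.Reachable.symm hK12
      · show K₁ 3 ∈ (event (ge 0) x t : Set (BondConfig (Site d)))
        rw [event_ge, openConnGe_zero, hzt]; exact SimpleGraph.Reachable.symm hK13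
  -- finitary lines
  have hfS : ∀ i, IsFinitary (AS i) := fun i => by
    rw [hAS]; fin_cases i; exacts [isFinitary_event (ge 0) 0 u, isFinitary_event (ge 0) 0 u]
  have hfM : ∀ i, IsFinitary (AM i) := fun i => by
    rw [hAM]; fin_cases i
    exacts [isFinitary_event (eq 1) u v, isFinitary_event (ge 1) v t, isFinitary_event (ge 2) t u]
  have hfE : ∀ i, IsFinitary (AE i) := fun i => by
    rw [hAE]; fin_cases i; exacts [isFinitary_event (ge 0) x t, isFinitary_event (ge 0) x t]
  -- grouped BK and the three letters
  calc piPerc d p 2 ({ω : Fin 2 → BondConfig (Site d) | s(u, v) ∈ ω 0} ∩ F)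
      ≤ piPerc d p 2 (genDisjOccGrouped (Sum.elim AS (Sum.elim AM AE)) (Sum.elim cS (Sum.elim cM cE)) tag3) :=
        measure_mono hincl
    _ ≤ piPerc d p 2 (genDisjOcc AS cS) * piPerc d p 2 (genDisjOcc AM cM) * piPerc d p 2 (genDisjOcc AE cE) :=
        piPerc_genDisjOccGrouped_tag3_le p AS AM AE cS cM cE hfS hfM hfE
    _ ≤ blockPS (Letters.perc d p) 0 u w *
          (Letters.perc d p).T (eq 1) (ge 1) (ge 2) (stepVec ι₀) (t - u) 0 *
          blockPE (Letters.perc d p) 0 (t - x) (z - x) := by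
        refine mul_le_mul' (mul_le_mul' ?_ ?_) ?_
        · rw [← hwu]; exact piPerc_start_zero_le_blockPS p u cS rfl
        · exact piPerc_mid_zero_zero_offBond_le_T p hv cM
        · exact piPerc_end_zero_le_blockPE p hzt.symm cE rfl

end Literature.Probability.FitznerVanDerHofstad2017
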